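import Summits.KontsevichZagierPeriods.KontsevichZagierPeriods.Theorems.PlanarK0Injective.Negative.Kit

/-!
# `PlanarK0Injective` (stmt-KontsevichZagierPeriods-9847) — negative side I: load-bearing hypotheses, scissors-only tightness, calibration

Refuter (`cdisprove`, cycle 1) by-products for the crux `PlanarK0Injective` of route `SymplecticScissors`,
on top of `Negative/Kit.lean`. Nothing here refutes the crux; these are checked facts a proof must
respect:

* §2 load-bearing hypotheses — `planarK0Injective_false_without_value_eq` (unit square vs
  `(0,2)×(0,1)`, soundness), `planarK0Injective_false_without_integrand_one` (`[(0,1)², 2]` vs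
  `(0,2)×(0,1)`, equal values; the additive `planarDefect` kills `planarGroup`).
* §3-II tightness — `not_planarScissorsOnly`: rule 1a alone cannot translate `(0,1)²` to
  `(2,3)×(0,1)` (`KZ.restrictedEval` through the window `(0,1)ⁿ`); so rule 2 is load-bearing.
  (The companion file `Negative/OneMove.lean` shows rule 1a is load-bearing.)
* §5 calibration — the hyperbolic dilation `diag(2, ½)` is ONE rule-2 move `(0,1)² → (0,2)×(0,½)`
  (shape is no invariant; template for affine symplectic moves between planar sets).
[Kontsevich–Zagier 2001, §1.2; Cresson–Viu-Sos 2022, Problem 2.1 / Rem. 2.3]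
-/

noncomputable section

open MeasureTheory Set MvPolynomial
open Literature.NumberTheory.Transcendental Literature.ModelTheory.ExponentialFields

namespace Summit.KontsevichZagierPeriods.SymplecticScissors.PlanarK0InjectiveNegative

/-! ## §2 Load-bearing hypotheses -/

/-- The crux with the hypothesis `r.value = r'.value` deleted (stated here only to be negated). -/
def PlanarK0InjectiveWithoutValueEq : Prop :=
  ∀ r r' : KZ.IntegralRep 2, (∀ p ∈ r.domain, r.integrand p = 1) →
    (∀ p ∈ r'.domain, r'.integrand p = 1) → KZ.of r - KZ.of r' ∈ planarGroup

/-- **Any proof must use `r.value = r'.value`**: the unit square and the `2 × 1` rectangle are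
planar sets with different areas, and the planar set-chain group is sound
(`eval_eq_zero_of_mem_planarGroup`). Witness: `(0,1)²` versus `(0,2) × (0,1)`. [folklore] -/
theorem planarK0Injective_false_without_value_eq : ¬ PlanarK0InjectiveWithoutValueEq := by
  intro h
  have hmem := h openUnitSquare (boxRep ![0, 0] ![2, 1]) (fun _ _ => rfl) (fun _ _ => rfl)
  have h0 := eval_eq_zero_of_mem_planarGroup hmem
  rw [map_sub, KZ.eval_of, KZ.eval_of, value_openUnitSquare,
    value_boxRep (fun i => by fin_cases i <;> simp)] at h0
  norm_num at h0

/-- The crux with the integrand-`1` hypothesis on `r` deleted (the one on `r'` kept; stated here only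
to be negated). -/
def PlanarK0InjectiveWithoutIntegrandOne : Prop :=
  ∀ r r' : KZ.IntegralRep 2, (∀ p ∈ r'.domain, r'.integrand p = 1) → r.value = r'.value →
    KZ.of r - KZ.of r' ∈ planarGroup

open Classical in
/-- The planar defect: a generator counts `1` unless it is a planar set (dimension 2, integrand `1`
on its domain). It kills `planarGroup` and detects representations that are not planar sets. [folklore] -/
def planarDefect : KZ.FormalRep →+ ℤ :=
  FreeAbelianGroup.lift fun p => if FreeAbelianGroup.of p ∈ planarGens then 0 else 1

/-- The planar defect kills the subgroup generated by planar sets. [folklore] -/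
theorem closure_planarGens_le_ker_planarDefect :
    AddSubgroup.closure planarGens ≤ planarDefect.ker := by
  refine (AddSubgroup.closure_le _).mpr fun x hx => ?_
  obtain ⟨s, hs, rfl⟩ := hx
  have hmem : FreeAbelianGroup.of (⟨2, s⟩ : Σ n, KZ.IntegralRep n) ∈ planarGens := ⟨s, hs, rfl⟩
  simp [planarDefect, KZ.of, hmem]

/-- The planar set-chain group lies in the subgroup generated by planar sets. [folklore] -/
theorem planarGroup_le_closure_planarGens : planarGroup ≤ AddSubgroup.closure planarGens :=
  (AddSubgroup.closure_le _).mpr fun _ hc => hc.2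

/-- The planar defect kills the planar set-chain group. [folklore] -/
theorem planarDefect_eq_zero_of_mem_planarGroup {c : KZ.FormalRep} (hc : c ∈ planarGroup) :
    planarDefect c = 0 :=
  AddMonoidHom.mem_ker.mp
    (closure_planarGens_le_ker_planarDefect (planarGroup_le_closure_planarGens hc))

/-- The unit square with the constant integrand `2` (value `2`, NOT a planar set). [folklore] -/
def twoSquare : KZ.IntegralRep 2 where
  domain := openUnitSquare.domain
  integrand := fun _ => 2
  isSemialgebraic_domain := openUnitSquare.isSemialgebraic_domain
  isSemialgebraicFunOn_integrand :=
    (isSemialgebraicFunOn_natCast openUnitSquare.isSemialgebraic_domain 2).congr fun _ _ => by simp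
  integrableOn := integrableOn_const (volume_box_ne_top _ _)

/-- `[(0,1)², 2]` has value `2`. [folklore] -/
theorem value_twoSquare : twoSquare.value = 2 := by
  have hle : (fun i => ((![0, 0] : Fin 2 → ℚ) i : ℝ)) ≤ fun i => ((![1, 1] : Fin 2 → ℚ) i : ℝ) :=
    fun i => by fin_cases i <;> simp
  simp only [KZ.IntegralRep.value, twoSquare, boxRep_domain, setIntegral_const, smul_eq_mul,
    Measure.real, box]
  rw [Real.volume_pi_Ioo_toReal hle]
  simp [Fin.prod_univ_two]

/-- `[(0,1)², 2]` is not a planar set (its integrand is `2 ≠ 1` at `(1/2, 1/2)`). [folklore] -/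
theorem of_twoSquare_not_mem_planarGens : KZ.of twoSquare ∉ planarGens := by
  rintro ⟨s, hs, hEq⟩
  have hinj := FreeAbelianGroup.of_injective hEq
  rw [Sigma.mk.inj_iff] at hinj
  obtain ⟨-, hrs⟩ := hinj
  have hrs' : twoSquare = s := eq_of_heq hrs
  have hp : (fun _ => (1:ℝ)/2 : Fin 2 → ℝ) ∈ twoSquare.domain := by
    show _ ∈ openUnitSquare.domain
    rw [mem_openUnitSquare]; norm_num
  have := hs _ (hrs' ▸ hp)
  rw [← hrs'] at this
  norm_num [twoSquare] at this

/-- `[(0,1)², 2]` has planar defect `1`. [folklore] -/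
theorem planarDefect_twoSquare : planarDefect (KZ.of twoSquare) = 1 := by
  simp [planarDefect, KZ.of]
  intro h
  exact (of_twoSquare_not_mem_planarGens h).elim

/-- Planar sets have planar defect `0`. [folklore] -/
theorem planarDefect_of_mem {s : KZ.IntegralRep 2} (hs : ∀ p ∈ s.domain, s.integrand p = 1) :
    planarDefect (KZ.of s) = 0 :=
  AddMonoidHom.mem_ker.mp
    (closure_planarGens_le_ker_planarDefect (AddSubgroup.subset_closure ⟨s, hs, rfl⟩))

/-- **Any proof must use the integrand-`1` hypotheses**: `[(0,1)², 2]` and the planar set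
`(0,2) × (0,1)` have the same value `2`, but their difference has planar defect `1 ≠ 0`, so it is
not even in the subgroup generated by planar sets, let alone in `planarGroup`. [folklore] -/
theorem planarK0Injective_false_without_integrand_one : ¬ PlanarK0InjectiveWithoutIntegrandOne := by
  intro h
  have hmem := h twoSquare (boxRep ![0, 0] ![2, 1]) (fun _ _ => rfl)
    (by rw [value_twoSquare, value_boxRep (fun i => by fin_cases i <;> simp)]; norm_num)
  have h0 := planarDefect_eq_zero_of_mem_planarGroup hmem
  rw [map_sub, planarDefect_twoSquare, planarDefect_of_mem (fun _ _ => rfl)] at h0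
  norm_num at h0

/-! ## §3-II Tightness: curved scissors alone do not suffice -/

/-- NATURAL STRENGTHENING II: curved scissors (rule 1a) alone, inside the planar sets (a refuted
strengthening, stated here only to be negated). -/
def PlanarScissorsOnly : Prop :=
  ∀ r r' : KZ.IntegralRep 2, (∀ p ∈ r.domain, r.integrand p = 1) →
    (∀ p ∈ r'.domain, r'.integrand p = 1) → r.value = r'.value →
    KZ.of r - KZ.of r' ∈ AddSubgroup.closure (KZ.domainAddRel ∩
      (AddSubgroup.closure planarGens : Set KZ.FormalRep))

/-- The unit-cube windows `(0,1)ⁿ`, one per dimension. [folklore] -/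
def unitWindow : (n : ℕ) → Set (Fin n → ℝ) := fun n => Set.pi univ fun _ : Fin n => Ioo (0 : ℝ) 1

/-- The windows are measurable. [folklore] -/
theorem measurableSet_unitWindow (n : ℕ) : MeasurableSet (unitWindow n) :=
  MeasurableSet.univ_pi fun _ => measurableSet_Ioo

/-- The open unit square is the window of dimension `2`. [folklore] -/
theorem openUnitSquare_domain_eq_unitWindow : openUnitSquare.domain = unitWindow 2 := by
  ext p; simp [mem_box, unitWindow, Fin.forall_fin_two]

/-- **Refuted strengthening / rule (2) is load-bearing**: `(0,1)²` and its translate `(2,3) × (0,1)`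
have the same area but are NOT related by curved scissors alone: domain additivity preserves the
area seen through the fixed window `(0,1)²` (`KZ.restrictedEval`), which is `1` for the first and
`0` for the second. [folklore] -/
theorem not_planarScissorsOnly : ¬ PlanarScissorsOnly := by
  intro h
  have hmem := h openUnitSquare (boxRep ![2, 0] ![3, 1]) (fun _ _ => rfl) (fun _ _ => rfl)
    (by rw [value_openUnitSquare, value_boxRep (fun i => by fin_cases i <;> norm_num)]; norm_num)
  have hle : AddSubgroup.closure (KZ.domainAddRel ∩
      (AddSubgroup.closure planarGens : Set KZ.FormalRep)) ≤ (KZ.restrictedEval unitWindow).ker :=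
    (AddSubgroup.closure_mono (fun c hc => Or.inl hc.1)).trans
      (KZ.closure_add_le_ker_restrictedEval unitWindow measurableSet_unitWindow)
  have h0 := AddMonoidHom.mem_ker.mp (hle hmem)
  have hA : openUnitSquare.domain ∩ unitWindow 2 = openUnitSquare.domain := by
    rw [openUnitSquare_domain_eq_unitWindow, inter_self]
  have hB : (boxRep ![2, 0] ![3, 1]).domain ∩ unitWindow 2 = ∅ := by
    ext p
    simp only [mem_inter_iff, mem_empty_iff_false, iff_false]
    rintro ⟨hp, hw⟩
    rw [boxRep_domain, mem_box] at hp
    have h1 := (hp 0).1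
    have h2 := (hw 0 (mem_univ _)).2
    simp at h1 h2
    linarith
  have hval := value_openUnitSquare
  simp only [KZ.IntegralRep.value] at hval
  rw [map_sub, KZ.restrictedEval_of, KZ.restrictedEval_of, hA, hB, hval] at h0
  simp at h0

/-! ## §5 Calibrations: candidate invariants that die by ONE explicit move (templates for provers) -/

/-- The hyperbolic dilation `diag(2, 1/2)` as a continuous linear map of the plane. [folklore] -/
def hypDilation : (Fin 2 → ℝ) →L[ℝ] (Fin 2 → ℝ) :=
  LinearMap.toContinuousLinearMap (Matrix.toLin' !![(2 : ℝ), 0; 0, 1 / 2])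

/-- The hyperbolic dilation in coordinates. [folklore] -/
theorem hypDilation_apply (p : Fin 2 → ℝ) : hypDilation p = ![2 * p 0, p 1 / 2] := by
  ext i
  fin_cases i <;> simp [hypDilation, Matrix.toLin'_apply, Matrix.mulVec, dotProduct,
    Fin.sum_univ_two, div_eq_mul_inv, mul_comm]

/-- The hyperbolic dilation has determinant `1`. [folklore] -/
theorem det_hypDilation : hypDilation.det = 1 := by
  rw [hypDilation, LinearMap.det_toContinuousLinearMap, LinearMap.det_toLin', Matrix.det_fin_two]
  simp

/-- The hyperbolic dilation is a polynomial map with rational coefficients, hence ℚ-semialgebraic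
on every ℚ-semialgebraic set. [folklore] -/
theorem isSemialgebraicMapOn_hypDilation {s : Set (Fin 2 → ℝ)} (hs : IsSemialgebraic ℚ s) :
    IsSemialgebraicMapOn ℚ s hypDilation := by
  refine (isSemialgebraicMapOn_aeval hs ![2 * X 0, C (1 / 2 : ℚ) * X 1]).congr fun p _ => ?_
  rw [hypDilation_apply]
  ext j
  fin_cases j <;> simp [div_eq_inv_mul, mul_comm]

/-- The hyperbolic dilation is injective. [folklore] -/
theorem injective_hypDilation : Function.Injective hypDilation := by
  intro p q h
  rw [hypDilation_apply, hypDilation_apply] at h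
  have h0 := congrFun h 0
  have h1 := congrFun h 1
  simp at h0 h1
  ext i
  fin_cases i
  · simpa using h0
  · simpa using h1

/-- The hyperbolic dilation maps `(0,1)²` onto `(0,2) × (0,1/2)`. [folklore] -/
theorem image_hypDilation_openUnitSquare :
    hypDilation '' openUnitSquare.domain = (boxRep ![0, 0] ![2, 1 / 2]).domain := by
  ext q
  constructor
  · rintro ⟨p, hp, rfl⟩
    rw [mem_openUnitSquare] at hp
    rw [boxRep_domain, mem_box, hypDilation_apply]
    intro i
    fin_cases i <;> simp <;> constructor <;> linarith [hp.1.1, hp.1.2, hp.2.1, hp.2.2]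
  · intro hq
    rw [boxRep_domain, mem_box] at hq
    have h0 := hq 0
    have h1 := hq 1
    simp at h0 h1
    refine ⟨![q 0 / 2, 2 * q 1], ?_, ?_⟩
    · rw [mem_openUnitSquare]
      simp
      refine ⟨⟨by linarith, by linarith⟩, by linarith, by linarith⟩
    · rw [hypDilation_apply]
      ext i
      fin_cases i
      · simp [mul_div_cancel₀]
      · simp

/-- **ASPECT RATIO IS NOT AN INVARIANT** (calibration): `[(0,1)²] − [(0,2) × (0,½)]` is ONE
change-of-variables move, via `diag(2, ½)` (|det| = 1, rational entries). Template for every affine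
symplectic move between planar sets. [folklore] -/
theorem of_openUnitSquare_sub_of_flatBox_mem_changeOfVariablesRel :
    KZ.of openUnitSquare - KZ.of (boxRep ![0, 0] ![2, 1 / 2]) ∈ KZ.changeOfVariablesRel :=
  ⟨2, openUnitSquare, boxRep ![0, 0] ![2, 1 / 2], hypDilation, fun _ => hypDilation,
    isSemialgebraicMapOn_hypDilation openUnitSquare.isSemialgebraic_domain,
    fun x _ => hypDilation.hasFDerivAt.hasFDerivWithinAt, injective_hypDilation.injOn,
    image_hypDilation_openUnitSquare.symm, fun x _ => by simp [det_hypDilation], rfl⟩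

/-- Hence the unit square and the flat box are congruent in the planar set-chain group
(equal area `1`, different shape): the smallest honest instance of the crux. [folklore] -/
theorem of_openUnitSquare_sub_of_flatBox_mem_planarGroup :
    KZ.of openUnitSquare - KZ.of (boxRep ![0, 0] ![2, 1 / 2]) ∈ planarGroup :=
  AddSubgroup.subset_closure ⟨Or.inr of_openUnitSquare_sub_of_flatBox_mem_changeOfVariablesRel,
    (AddSubgroup.closure planarGens).sub_mem (AddSubgroup.subset_closure ⟨_, fun _ _ => rfl, rfl⟩)
      (AddSubgroup.subset_closure ⟨_, fun _ _ => rfl, rfl⟩)⟩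

end Summit.KontsevichZagierPeriods.SymplecticScissors.PlanarK0InjectiveNegative
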